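import Literature.NumberTheory.K2Lit.LocalDoublingUnramifiedHecke
import Literature.NumberTheory.Automorphic.CartanDecompositionGLnUnique
import Literature.NumberTheory.Automorphic.WhittakerCoeffLocalDatum
import Literature.NumberTheory.Automorphic.UnitaryGroupSplitPlace

/-!
# The Cartan family of `G_v = U(V)(L⁺_v)` at a SPLIT place (LOCAL SEAM of s23, file #26 — split half)

Track B ∕ K2-LIT, hLiu418 = stmt-HodgeConjecture-24832; DEPMAP `Cruxes/HLiu418/Lines/K2_Liu_LocalSeam_s23.md` §3 row #26 (split half; the inert
`U(1,1)` half is the separate file `K2LiuCartanUnitaryRankOneLocal`). Helper (count-neutral, own head per LEAD R3).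

For the K2Lit hermitian space `V = ⟨dV⟩` (`dV` real, non-zero), a finite place `v` of `L⁺` SPLIT in `L` (`w ∣ v`, `c w ≠ w`) with `dV` unitary at `w`
(all but finitely many `v`) and a uniformizer `ϖ` of `L_w`, the elements

  `t_a := e_w⁻¹ diag(ϖ^{a_1}, …, ϖ^{a_N}) ∈ G_v`,  `a ∈ ℤ^N` antitone,  `e_w = ★ localPiSplitEquiv : G_v ≃ GL_N(L_w)`

form a ★ D7d `IsCartanFamily` for `K_v = ★ UnitaryGroup.localInt` — `G_v = ⨆_a K_v t_a K_v` DISJOINTLY (`isCartanFamily_localInt_split`) — and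
`(t_a)_w = diag(ϖ^{a_i})` (`coe_cartanSplit_apply`, the `ht` hypothesis of ★ #27 `lambdaLoc_iotaLeftLocPi_diagonal_split`). Proof: transport along
`e_w` (`K_v ↔ GL_N(𝒪_w)`, ★ `localPiSplitEquiv_symm_mem_localInt_iff`) of the tree's Cartan decomposition of `GL_N` over the discretely valued field
`L_w` WITH uniqueness: ★ `exists_glInt_mul_mul_eq_zpowDiagGL` ([CartierCorvallis1979, §IV.2]; [Bump1997, Prop. 4.6.2]) and ★
`CartanUnique.eq_of_glInt_mul_zpowDiagGL_mul_eq_of_antitone` ([Macdonald1995, Ch. V §2 (2.2)]). No `def`, no `sorry`.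
HONEST LABEL: HC_CM is proved only modulo the printed citations (2 remaining named inputs: hLiu418 = stmt-HodgeConjecture-24832, h413 =
stmt-HodgeConjecture-24833) until rung 0 closes; this file is unconditional and moves no counter.
-/

set_option autoImplicit false

set_option linter.dupNamespace false

noncomputable section

open scoped Matrix ValuativeRel
open NumberField IsDedekindDomain Matrix

namespace Summit.HodgeConjecture.HodgeConjecture.Cruxes.HLiu418.K2LiuCartanFamilySplit

open Literature.NumberTheory.Automorphic Literature.NumberTheory.Automorphic.UnitaryGroup
open Literature.NumberTheory.GelbartRogawski1991 Literature.NumberTheory.GelbartRogawski1991.GRConstruction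
open Literature.NumberTheory.K2Lit Literature.NumberTheory.K2Lit.SiegelDoubled

variable (L : Type) [Field L] [NumberField L] [IsCMField L]
variable {N : ℕ} (dV : Fin N → L) (hdV : ∀ i, IsCMField.complexConj L (dV i) = dV i) (hdV0 : ∀ i, dV i ≠ 0)
  (v : HeightOneSpectrum (𝓞 (Fp L)))

/-! ## §1 The diagonal form at a place -/

include hdV in
/-- `diag(dV)` is hermitian: `(c diag(dV))ᵀ = diag(dV)` for real `dV`. [cite: PlatonovRapinchuk1994, §5.1] -/
theorem transpose_map_diagonal : ((Matrix.diagonal dV).map (IsCMField.complexConj L))ᵀ = Matrix.diagonal dV := by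
  rw [Matrix.diagonal_map (map_zero _), Matrix.diagonal_transpose]
  exact congrArg Matrix.diagonal (funext hdV)

omit [IsCMField L] in
include hdV0 in
/-- `diag(dV)` is invertible at every place `w` of `L`. [cite: PlatonovRapinchuk1994, §5.1] -/
theorem isUnit_placeForm_diagonal (w : HeightOneSpectrum (𝓞 L)) : IsUnit (UnitaryGroup.placeForm (Matrix.diagonal dV) w) :=
  UnitaryGroup.isUnit_placeForm (Matrix.diagonal dV) ((Matrix.isUnit_iff_isUnit_det _).2
    (by rw [Matrix.det_diagonal]; exact isUnit_iff_ne_zero.2 (Finset.prod_ne_zero_iff.2 fun i _ => hdV0 i))) w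

omit [IsCMField L] in
/-- at a place where every `dV i` is a `w`-unit, `diag(dV)_w ∈ GL_N(𝒪_w)`. [cite: PlatonovRapinchuk1994, §5.1] -/
theorem unit_placeForm_diagonal_mem_glInt (w : HeightOneSpectrum (𝓞 L))
    (hgood : ∀ i, ValuativeRel.valuation (w.adicCompletion L) (algebraMap L (w.adicCompletion L) (dV i)) = 1) :
    (isUnit_placeForm_diagonal L dV hdV0 w).unit ∈ glInt N (w.adicCompletion L) := by
  have h0 : ∀ i, algebraMap L (w.adicCompletion L) (dV i) ≠ 0 := fun i h0 => by
    have := hgood i; rw [h0, map_zero] at this; exact zero_ne_one this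
  have heq : (isUnit_placeForm_diagonal L dV hdV0 w).unit =
      diagonalGL (Fin N) (w.adicCompletion L) fun i => Units.mk0 _ (h0 i) := by
    refine Units.ext ?_
    rw [IsUnit.unit_spec, coe_diagonalGL, UnitaryGroup.placeForm, Matrix.diagonal_map (map_zero _)]
    rfl
  rw [heq]
  exact diagonalGL_mem_glInt fun i => hgood i

/-! ## §2 The Cartan family at a split place -/

omit [IsCMField L] in
/-- a uniformizer of `L_w` (normalised valuation `exp (−1)`) is non-zero. [cite: CasselsFrohlichANT1967, Ch. II §10] -/
theorem ne_zero_of_valued_eq {w : HeightOneSpectrum (𝓞 L)} {ϖ : w.adicCompletion L} (hϖ : Valued.v ϖ = WithZero.exp (-1 : ℤ)) :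
    ϖ ≠ 0 :=
  (isUniformizingElement_of_valued_eq L w hϖ).ne_zero

include hdV hdV0 in
/-- the `w`-component of the Cartan representative `t_a = e_w⁻¹ diag(ϖ^{a_i})` is `diag(ϖ^{a_i})`. [cite: Macdonald1995, Ch. V §2 (2.2)] -/
theorem coe_cartanSplit_apply (w : UnitaryGroup.PlacesOver L v) (hw : IsCMField.complexConj L • w.1 ≠ w.1)
    {ϖ : w.1.adicCompletion L} (hϖ : Valued.v ϖ = WithZero.exp (-1 : ℤ)) (a : Fin N → ℤ) :
    Units.val (((((UnitaryGroup.localPiSplitEquiv (IsCMField.complexConj L) (Matrix.diagonal dV) (IsCMField.complexConj_ne_one L)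
        (transpose_map_diagonal L dV hdV) w hw (isUnit_placeForm_diagonal L dV hdV0 w.1)).symm
          (zpowDiagGL (ne_zero_of_valued_eq L hϖ) a) :
        UnitaryGroup.localPi L (IsCMField.complexConj L) N (Matrix.diagonal dV) v) : UnitaryGroup.LocalGLPi L N v) w)) =
      Matrix.diagonal fun i => ϖ ^ a i := by
  rw [← UnitaryGroup.localPiSplitEquiv_apply (IsCMField.complexConj L) (Matrix.diagonal dV) (IsCMField.complexConj_ne_one L)
      (transpose_map_diagonal L dV hdV) w hw (isUnit_placeForm_diagonal L dV hdV0 w.1), ContinuousMulEquiv.apply_symm_apply,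
    coe_zpowDiagGL]

include hdV hdV0 in
/-- **The Cartan decomposition of `G_v = U(V)(L⁺_v)` at a split place, as a ★ `IsCartanFamily`**: with `K_v = U(V)(𝒪_v)` and
`t_a = e_w⁻¹ diag(ϖ^{a_1}, …, ϖ^{a_N})`, `a_1 ≥ ⋯ ≥ a_N`, every `g ∈ G_v` lies in exactly one `K_v t_a K_v`.
[cite: Macdonald1995, Ch. V §2 (2.2)] [cite: CartierCorvallis1979, §IV.2] [cite: Bump1997, Prop. 4.6.2] -/
theorem isCartanFamily_localInt_split (w : UnitaryGroup.PlacesOver L v) (hw : IsCMField.complexConj L • w.1 ≠ w.1)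
    (hgood : ∀ i, ValuativeRel.valuation (w.1.adicCompletion L) (algebraMap L (w.1.adicCompletion L) (dV i)) = 1)
    {ϖ : w.1.adicCompletion L} (hϖ : Valued.v ϖ = WithZero.exp (-1 : ℤ)) :
    IsCartanFamily (UnitaryGroup.localInt L (IsCMField.complexConj L) N (Matrix.diagonal dV) v)
      (fun a : {a : Fin N → ℤ // Antitone a} =>
        (UnitaryGroup.localPiSplitEquiv (IsCMField.complexConj L) (Matrix.diagonal dV) (IsCMField.complexConj_ne_one L)
          (transpose_map_diagonal L dV hdV) w hw (isUnit_placeForm_diagonal L dV hdV0 w.1)).symm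
            (zpowDiagGL (ne_zero_of_valued_eq L hϖ) a.1)) := by
  have hϖU : IsUniformizingElement ϖ := isUniformizingElement_of_valued_eq L w.1 hϖ
  set eW := UnitaryGroup.localPiSplitEquiv (IsCMField.complexConj L) (Matrix.diagonal dV) (IsCMField.complexConj_ne_one L)
    (transpose_map_diagonal L dV hdV) w hw (isUnit_placeForm_diagonal L dV hdV0 w.1) with heW
  have hJi := unit_placeForm_diagonal_mem_glInt L dV hdV0 w.1 hgood
  have hKi : ∀ g : GL (Fin N) (w.1.adicCompletion L),
      eW.symm g ∈ UnitaryGroup.localInt L (IsCMField.complexConj L) N (Matrix.diagonal dV) v ↔ g ∈ glInt N (w.1.adicCompletion L) :=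
    UnitaryGroup.localPiSplitEquiv_symm_mem_localInt_iff (IsCMField.complexConj L) (Matrix.diagonal dV) (IsCMField.complexConj_ne_one L)
      (transpose_map_diagonal L dV hdV) w hw (isUnit_placeForm_diagonal L dV hdV0 w.1) hJi
  have hKe : ∀ {u : UnitaryGroup.localPi L (IsCMField.complexConj L) N (Matrix.diagonal dV) v},
      u ∈ UnitaryGroup.localInt L (IsCMField.complexConj L) N (Matrix.diagonal dV) v → eW u ∈ glInt N (w.1.adicCompletion L) :=
    fun {u} hu => by rw [← hKi, ContinuousMulEquiv.symm_apply_apply]; exact hu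
  refine ⟨fun g => ?_, fun a b hab => ?_⟩
  · -- existence: `e_w g = k₁⁻¹ ϖ^a k₂⁻¹`
    obtain ⟨k₁, hk₁, k₂, hk₂, a, ha, h⟩ := exists_glInt_mul_mul_eq_zpowDiagGL hϖU (eW g)
    refine ⟨⟨a, ha⟩, DoubleCoset.mem_doubleCoset.2 ⟨eW.symm k₁⁻¹, (hKi _).2 (inv_mem hk₁), eW.symm k₂⁻¹, (hKi _).2 (inv_mem hk₂), ?_⟩⟩
    apply eW.injective
    have hz : zpowDiagGL (ne_zero_of_valued_eq L hϖ) a = zpowDiagGL hϖU.ne_zero a := rfl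
    rw [map_mul, map_mul, ContinuousMulEquiv.apply_symm_apply, ContinuousMulEquiv.apply_symm_apply, ContinuousMulEquiv.apply_symm_apply,
      hz, ← h]
    group
  · -- uniqueness of the antitone exponents
    obtain ⟨g, hga, hgb⟩ := hab
    obtain ⟨x, hx, y, hy, hgxy⟩ := DoubleCoset.mem_doubleCoset.1 hga
    obtain ⟨x', hx', y', hy', hgxy'⟩ := DoubleCoset.mem_doubleCoset.1 hgb
    apply Subtype.ext
    refine CartanUnique.eq_of_glInt_mul_zpowDiagGL_mul_eq_of_antitone hϖU a.2 b.2
      (k₁ := (eW x')⁻¹ * eW x) (k₂ := eW y * (eW y')⁻¹)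
      (Subgroup.mul_mem _ (Subgroup.inv_mem _ (hKe hx')) (hKe hx)) (Subgroup.mul_mem _ (hKe hy) (Subgroup.inv_mem _ (hKe hy'))) ?_
    have ha : eW g = eW x * zpowDiagGL hϖU.ne_zero a.1 * eW y := by
      rw [hgxy, map_mul, map_mul, ContinuousMulEquiv.apply_symm_apply]
    have hb : eW g = eW x' * zpowDiagGL hϖU.ne_zero b.1 * eW y' := by
      rw [hgxy', map_mul, map_mul, ContinuousMulEquiv.apply_symm_apply]
    calc (eW x')⁻¹ * eW x * zpowDiagGL hϖU.ne_zero a.1 * (eW y * (eW y')⁻¹)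
        = (eW x')⁻¹ * (eW x * zpowDiagGL hϖU.ne_zero a.1 * eW y) * (eW y')⁻¹ := by group
      _ = (eW x')⁻¹ * (eW x' * zpowDiagGL hϖU.ne_zero b.1 * eW y') * (eW y')⁻¹ := by rw [← ha, hb]
      _ = zpowDiagGL hϖU.ne_zero b.1 := by group

end Summit.HodgeConjecture.HodgeConjecture.Cruxes.HLiu418.K2LiuCartanFamilySplit

end
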